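import Literature.Geometry.Lorentzian.KerrDeSitterSurfaceGravities
import Literature.Geometry.Lorentzian.SchwarzschildDeSitterScalarModeStability
import HarnessLib

/-!
# Venture KdS — the doubly-resonant candidates, VIII: no doubly-resonant stratum on
# Schwarzschild–de Sitter (`a = 0`)

HONEST FRAMING (venture `Summits/Ventures/KdS`, cell `pub-kds`; optional kernel object of the
Monday S3 seat). P1 g7 (`theory/q3prime/README.md`, structural by-product): "the ratio
`κ₂/κ₁ = (s − 1 − i₀)/(j − s)` is `> 1` on the whole family, so doubly-resonant points exist ONLY in
the near-extremal regime `κ₂ > κ₁`". This file makes the `a = 0` end of that remark a theorem, which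
is also why the T10 files may assume `a ≠ 0` (four real roots `r_n < 0 < r₋ < r₊ < r_c`) without
loss: on subextremal Schwarzschild–de Sitter
* (tree: `rMinus_zero_a` of `SchwarzschildDeSitterScalarModeStability` — `rMinus M 0 Λ = 0`);
* `surfaceGravity_rCosmo_lt_rPlus_of_static`: `κ_c < κ₊`
  (`κ₊ − κ_c = (Λ/6)(r_c − r₊)(r_c/r₊ − r₊/r_c)`);
* ★ `a_ne_zero_of_resonance`: a doubly-resonant stratum `y = u·κ_c = (s − 1 − i₀)·κ₊` with `u > 0`
  and `s − 1 − i₀ > u` (i.e. degree `d = s − 2 − i₀ − u ≥ 0`) forces `κ_c > κ₊`, hence `a ≠ 0`.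
0 cited facts, no `sorry`.
-/

noncomputable section

open Set

namespace Summit.Ventures.KdS.RouteW.DoublyResonant

open Literature.Geometry.Lorentzian Literature.Geometry.Lorentzian.KerrDeSitter

/-- **`κ_c < κ₊` on subextremal Schwarzschild–de Sitter**: with `r₋ = 0` and `Ξ = 1`,
`κ₊ = (Λ/6)(r_c − r₊)(2r₊ + r_c)/r₊`, `κ_c = (Λ/6)(r_c − r₊)(r₊ + 2r_c)/r_c`, and
`(2r₊ + r_c)/r₊ − (r₊ + 2r_c)/r_c = r_c/r₊ − r₊/r_c > 0`. -/
theorem surfaceGravity_rCosmo_lt_rPlus_of_static {M Λ : ℝ} (hsub : IsSubextremal M 0 Λ) :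
    surfaceGravity M 0 Λ (rCosmo M 0 Λ) < surfaceGravity M 0 Λ (rPlus M 0 Λ) := by
  have h0 := rMinus_zero_a hsub
  rw [surfaceGravity_rCosmo_eq hsub, surfaceGravity_rPlus_eq hsub, h0]
  obtain ⟨hM, hΛ, h01, h12, -⟩ := hsub
  rw [h0] at h01
  have hX : xi 0 Λ = 1 := by unfold xi; ring
  rw [hX]
  have hp : 0 < rPlus M 0 Λ := h01
  have hc : 0 < rCosmo M 0 Λ := h01.trans h12
  rw [div_lt_div_iff₀ (by positivity) (by positivity)]
  have hΛ3 : 0 < Λ / 3 := by positivity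
  -- both sides share the positive factor `(Λ/3)(r_c − r₊)·2`; compare the rest
  have key : rCosmo M 0 Λ * (0 + rPlus M 0 Λ + 2 * rCosmo M 0 Λ) * (rPlus M 0 Λ ^ 2 + 0 ^ 2) <
      rPlus M 0 Λ * (0 + 2 * rPlus M 0 Λ + rCosmo M 0 Λ) * (rCosmo M 0 Λ ^ 2 + 0 ^ 2) := by
    nlinarith [mul_pos hp hc,
      mul_pos (mul_pos hp hc) (show 0 < rCosmo M 0 Λ - rPlus M 0 Λ by linarith),
      mul_pos (mul_pos hp hc) (show 0 < rCosmo M 0 Λ + rPlus M 0 Λ by linarith)]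
  have hf : 0 < Λ / 3 * (rCosmo M 0 Λ - rPlus M 0 Λ) * 2 := by
    have : 0 < rCosmo M 0 Λ - rPlus M 0 Λ := by linarith
    positivity
  nlinarith [mul_lt_mul_of_pos_left key hf]

/-- ★ **A doubly-resonant stratum forces `a ≠ 0`.** If `y = u·κ_c = v·κ₊` with `0 < u < v` (T10:
`v = s − 1 − i₀ = 1 + u + d`), then `κ_c > κ₊`, impossible at `a = 0`. -/
theorem a_ne_zero_of_resonance {M a Λ : ℝ} (hsub : IsSubextremal M a Λ) {u v y : ℝ} (hu : 0 < u)
    (huv : u < v) (hyc : y = u * surfaceGravity M a Λ (rCosmo M a Λ))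
    (hyp : y = v * surfaceGravity M a Λ (rPlus M a Λ)) : a ≠ 0 := by
  rintro rfl
  have hlt := surfaceGravity_rCosmo_lt_rPlus_of_static hsub
  have hκp := surfaceGravity_rPlus_pos hsub
  have hκc := surfaceGravity_rCosmo_pos hsub
  have h : u * surfaceGravity M 0 Λ (rCosmo M 0 Λ) = v * surfaceGravity M 0 Λ (rPlus M 0 Λ) := by
    rw [← hyc, ← hyp]
  nlinarith [mul_lt_mul_of_pos_left hlt hu, mul_lt_mul_of_pos_right huv hκp]

end Summit.Ventures.KdS.RouteW.DoublyResonant
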